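import Literature.MathematicalPhysics.QuantumFieldTheory.Balaban1983to89.B8Eq191FlatLettersExplicit
import Literature.MathematicalPhysics.QuantumFieldTheory.Balaban1983to89.B8Eq191FlatBoundsTransfer

/-!
# `Balaban1983to89.B8Eq191FlatLettersRDOfReal` — [Balaban1985RegularSpaces] (1.91)–(1.92) p. 91, (1.95)–(1.98) p. 92, (1.101) p. 93 AT `U₀ = 1`:
# THE COMPLETE [4]-LETTERS BLOCK OF THE JOIN (`B8SockLettersRD.SockLettersRD`'s body at background `1`: seven letters, eleven laws, FIVE BOUNDS)
# ON A FINITE DIRICHLET REGION, FROM THREE FAMILIES OF INEQUALITIES FOR REAL LATTICE FUNCTIONS ON THE EXPLICIT MATRICES `T⁻¹`,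
# `T⁻²Qᵀ(QT⁻²Qᵀ)⁻¹`, `T⁻¹Qᵀ(QT⁻²Qᵀ)⁻¹QT⁻¹`

statement-level skeleton of published theorems with citation tags; proofs where landed; nothing here is a claim about the
Yang–Mills mass gap

`[Balaban1985RegularSpaces]` ("B8", CMP **99** (1985) 75–102) (1.91)–(1.92) p. 91, (1.95)–(1.98) p. 92, (1.101) p. 93, p. 96 («`Q′H′ = I`»), Prop. 5 p. 94,
Prop. 6 p. 99; [4] = `[Balaban1985BackgroundPropagators]` Thms 3.1–3.2 p. 397, (3.19) p. 393, (3.23)–(3.25) p. 394 («⊗ id»); [B6] =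
`[Balaban1984PropagatorsII]` p. 235.

CITATION HEADER (lean-in-tree rule).  Cell `pub-ymgap` (D-0062), DAG node N05 = [B8], seat `pub-ymgap-dag-n05-e` (g4; R141 (C), FAN-OUT §N05 row s3b — THE
FLAT CURRENCY for Proposition 6).  The consumer of the [4]-letters at a datum is `B8SockHFPRD.sockHFP_body_of_join_RD` (n05-d), whose letters block
(= the body of `B8SockLettersRD.SockLettersRD` at one background and one truncation) has 7 letters and 16 binders: 11 algebraic laws and the FIVE
BOUNDS `hH0 hH1 hH2` (1.92), `hG` (1.101), `hRbd` (1.98).  At `U₀ = 1` the seat's g3 files CONSTRUCT the letters with the 11 laws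
(`B8Eq191FlatLettersExplicit.exists_flatLetters_dirichlet_explicit`, kernels displayed) and g4's `B8Eq191FlatBoundsTransfer` reduces the five bounds
for `𝔸`-valued fields to the same bounds for REAL lattice functions.  THIS FILE closes the circle: ★ `flatLettersRD_of_real` — on a finite
Dirichlet region with a finite tower structure (file 6's data `S, 𝔅, K, T, Q` as letters with defining equations), IF the three REAL inequality
families `realG` ((1.101) for `T⁻¹`), `realH` ((1.92) + the p. 93 `Δ`-entry for `T⁻¹(T⁻¹Qᵀ)(QT⁻¹T⁻¹Qᵀ)⁻¹`), `realR` ((1.98) for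
`1 − T⁻¹Qᵀ(QT⁻¹T⁻¹Qᵀ)⁻¹QT⁻¹`) hold with constants `B_G, B′₀, B₂′, B_R`, THEN the complete 16-binder letters block of the JOIN holds at `U₀ := 1`
(conclusion = VERBATIM the body of `SockLettersRD` at background `1`, truncation `n`, structure `Λs`).  New content beyond composition: the
composite kernel of `G′QᵀCQG′` (§1 of the proof: `T⁻¹·Qᵀ·(QT⁻²Qᵀ)⁻¹·Q·T⁻¹`, from the displayed kernels of `G′`, `C` and the flat readings of
`Q′`, `Q′ᵀ` — `QprimeIter_flat_eq_sum_of_supp`, `QT_flat_apply`, `tower_sum_eq`, `kernel_comp`).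

HONEST SCOPE.  Finite-dimensional linear algebra + the sign trick; NO estimate of [4] is proved — the three real families are HYPOTHESES
([4] Thms 3.1–3.2 at `U = 1`, Dirichlet, for real lattice functions).  Count-neutral; N05 NOT discharged; one finite `T⁴` programme at fixed `ε`,
Bałaban as printed; nothing continuum ∕ ℝ⁴ ∕ OS ∕ mass-gap ∕ Clay.  No `sorry`, no `def`, no `instance`, no `notation`.  Unit `pub-ymgap-dag-n05-e`
(g4), 2026-08-27.
-/

noncomputable section

namespace Literature.MathematicalPhysics.QuantumFieldTheory.Balaban1983to89.B8Eq191FlatLettersRDOfReal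

open Finset
open scoped Matrix
open B7Prop1Explicit (e)
open B7Eq78Linearization (QprimeIter zdBlocking)
open B8Ineq132 (covDerivFwd)
open B8Eq119TwistedAxial (bgT)
open B8Eq138LandauZd (covLap QT)
open B8Eq140Level (SideTouches)
open B8Eq1117Concrete (XSpace)
open B8Prop5ContractionKLevel (Bd2)
open B8LambdaSpaceKLevel (wt)
open Literature.MathematicalPhysics.QuantumLattice (blockMap)
open B8Eq191FlatStencils (QT_flat_apply QprimeIter_flat_eq_sum_of_supp)
open B8Eq191FlatLettersDirichlet (kernel_comp tower_sum_eq)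
open B8Eq191FlatLettersExplicit (exists_flatLetters_dirichlet_explicit)
open B8Eq191FlatBoundsTransfer (hG_flat_of_real hH_flat_of_real hRbd_flat_of_real)

-- `Site` alone could resolve to the torus sites of `Setup.lean`; re-export the `ℤ^d` sites of `B7Prop1Explicit`.
export B7Prop1Explicit (Site)

variable {d : ℕ}

section Letters

variable {𝔸 : Type*} [CStarAlgebra 𝔸]

open Classical in
/-- ★ **THE COMPLETE [4]-LETTERS BLOCK OF THE JOIN AT `U₀ = 1` ON A FINITE DIRICHLET REGION, FROM THREE REAL INEQUALITY FAMILIES ON THE EXPLICIT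
MATRICES.**  DATA (as `B8Eq191FlatLettersExplicit.exists_flatLetters_dirichlet_explicit`): `d ≥ 1`, `η > 0`, `L ≥ 1`, a truncation `n`, level regions
`Ω_j ⊆ Ω₀ = Ω 0` (`j ≤ n`), a structure `{Λ_j}_{j ≤ n}` whose tower blocks are pairwise disjoint on `Ω₀` and meet `Ω₀`, weights `a_j ≥ 0`; the region
listed by `S`, the tower index set `𝔅 = {(j,y) ∣ j ≤ n, y ∈ Λ_j}` by `B`, the flat kernel `K = η⁻²(2d·δ − Σ_μ(δ_{+μ} + δ_{−μ})) + Σ_j a_jL^{−2dj}[y_j(z)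
= y_j(x) ∈ Λ_j]`, the matrices `T = (K(x,z))_{x,z∈Ω₀}`, `Q = (L^{−dj}[y_j(z) = y])`.  HYPOTHESES — THREE FAMILIES OF INEQUALITIES FOR REAL LATTICE
FUNCTIONS (the currency of [4] Thms 3.1–3.2 at `U = 1`): `realG` = (1.101) for `T⁻¹` (for every real `ρ` on `Ω₀` with the `(−2)`-profile `≤ r` on
the `Ω_j`, the field `φ = T⁻¹ρ` (extended by `0`) has `|φ| ≤ B_G r` and `(Lʲη)|η⁻¹(φ(x + e_μ) − φ(x))| ≤ B_G r` on the sides of the plaquettes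
touching `Ω_j`); `realH` = (1.92) + the p. 93 `Δ`-entry for `T⁻¹(T⁻¹Qᵀ)(QT⁻¹T⁻¹Qᵀ)⁻¹` (for every real `X` on `𝔅` with `|X| ≤ s`: `|φ| ≤ B′₀s`,
`(Lʲη)|∇φ| ≤ B′₀s` on the sides touching `Ω_j`, `(Lʲη)²|Δ^η φ| ≤ B₂′s` on `Ω_j`); `realR` = (1.98) for `1 − T⁻¹Qᵀ(QT⁻¹T⁻¹Qᵀ)⁻¹QT⁻¹`
(`(Lʲη)²|ρ(w) − Σ_z(…)(w,z)ρ(z)| ≤ B_R r` on `Ω_j`).  CONCLUSION — VERBATIM THE BODY OF `B8SockLettersRD.SockLettersRD` AT BACKGROUND `1`,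
TRUNCATION `n`, STRUCTURE `Λs`: seven letters `g Δ q qs Aw c H′` with `g_rightΩ`, `c_range`, `hΔ`, `hqs`, `hq`, `hH0`, `hH1`, `hH2`, `hHsupp`,
`hHequiv`, `hQH`, `hG`, `hGsupp`, `hGreal`, `hRbd`, `hRreal` — the sixteen binders of `B8SockHFPRD.sockHFP_body_of_join_RD` at `U₀ := 1`.  PROOF:
the letters and eleven laws from file 6; the composite kernel of `G′QᵀCQG′` is `T⁻¹·Qᵀ·(QT⁻²Qᵀ)⁻¹·Q·T⁻¹` (kernel algebra); the five bounds by
`B8Eq191FlatBoundsTransfer` (real kernel ⊗ id).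
[cite: Balaban1985RegularSpaces, (1.91)–(1.92) p.91, (1.95)–(1.98) p.92, (1.101) p.93, p.96 («Q′H′ = I»), Prop. 5 p.94; Balaban1985BackgroundPropagators, Thms 3.1–3.2 p.397, (3.23)–(3.25) p.394; Balaban1984PropagatorsII, p.235] -/
theorem flatLettersRD_of_real (hd : 0 < d) {η : ℝ} (hη : 0 < η) {L : ℕ} (hL : 1 ≤ L) (n : ℕ) (Ω : ℕ → Set (Site d))
    (hΩ0 : ∀ j, j ≤ n → Ω j ⊆ Ω 0) (Λs : ℕ → Set (Site d)) (a : ℕ → ℝ) (ha : ∀ j, 0 ≤ a j)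
    (S : Finset (Site d)) (hS : ∀ w, w ∈ S ↔ w ∈ Ω 0)
    (hmeet : ∀ j, j ≤ n → ∀ y ∈ Λs j, ∃ z ∈ Ω 0, blockMap (L ^ j) z = y)
    (hdisj : ∀ j, j ≤ n → ∀ j', j' ≤ n → ∀ y ∈ Λs j, ∀ y' ∈ Λs j', ∀ z ∈ Ω 0,
      blockMap (L ^ j) z = y → blockMap (L ^ j') z = y' → j = j' ∧ y = y')
    (B : Finset (ℕ × Site d)) (hB : ∀ p, p ∈ B ↔ p.1 ≤ n ∧ p.2 ∈ Λs p.1)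
    (K : Site d → Site d → ℝ)
    (hK : ∀ x z, K x z = ((η ^ 2)⁻¹ * ∑ μ : Fin d, ((2 : ℝ) * (if z = x then (1 : ℝ) else 0) - (if z = x + e μ then (1 : ℝ) else 0)
      - (if z = x - e μ then (1 : ℝ) else 0))) +
      (∑ j ∈ Finset.range (n + 1), (if blockMap (L ^ j) x ∈ Λs j ∧ blockMap (L ^ j) z = blockMap (L ^ j) x then
        a j * ((((L : ℝ) ^ d)⁻¹) ^ j) ^ 2 else 0)))
    (T : Matrix ↥S ↥S ℝ) (hT : T = Matrix.of fun x z : ↥S => K x.1 z.1)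
    (Q : Matrix ↥B ↥S ℝ)
    (hQ : Q = Matrix.of fun (p : ↥B) (z : ↥S) => if blockMap (L ^ p.1.1) z.1 = p.1.2 then (((L : ℝ) ^ d)⁻¹) ^ p.1.1 else 0)
    {BG B₀'H B₂' BR : ℝ}
    -- (1.101) for `T⁻¹`, real lattice functions
    (realG : ∀ (ρ : ↥S → ℝ) (r : ℝ), 0 ≤ r → (∀ j, j ≤ n → ∀ z : ↥S, z.1 ∈ Ω j → wt L η j ^ 2 * |ρ z| ≤ r) →
      ∀ φ : Site d → ℝ, (∀ x, x ∉ Ω 0 → φ x = 0) → (∀ w : ↥S, φ w.1 = ∑ z : ↥S, T⁻¹ w z * ρ z) →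
      (∀ x, |φ x| ≤ BG * r) ∧
      ∀ j, j ≤ n → ∀ p ∈ {b : Site d × Fin d | SideTouches (Ω j) b.1 b.2},
        wt L η j * |η⁻¹ * (φ (p.1 + e p.2) - φ p.1)| ≤ BG * r)
    -- (1.92) and the p. 93 `Δ`-entry for `T⁻¹(T⁻¹Qᵀ)(QT⁻¹T⁻¹Qᵀ)⁻¹`, real `X`
    (realH : ∀ (X : ↥B → ℝ) (s : ℝ), 0 ≤ s → (∀ p', |X p'| ≤ s) →
      ∀ φ : Site d → ℝ, (∀ x, x ∉ Ω 0 → φ x = 0) →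
      (∀ w : ↥S, φ w.1 = ∑ p' : ↥B, (T⁻¹ * (T⁻¹ * Qᵀ) * (Q * T⁻¹ * T⁻¹ * Qᵀ)⁻¹) w p' * X p') →
      (∀ x, |φ x| ≤ B₀'H * s) ∧
      (∀ j, j ≤ n → ∀ p ∈ {b : Site d × Fin d | SideTouches (Ω j) b.1 b.2},
        wt L η j * |η⁻¹ * (φ (p.1 + e p.2) - φ p.1)| ≤ B₀'H * s) ∧
      (∀ j, j ≤ n → ∀ x ∈ Ω j,
        wt L η j ^ 2 * |∑ μ : Fin d, (η ^ 2)⁻¹ * (2 * φ x - φ (x + e μ) - φ (x - e μ))| ≤ B₂' * s))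
    -- (1.98) for `1 − T⁻¹Qᵀ(QT⁻¹T⁻¹Qᵀ)⁻¹QT⁻¹`, real lattice functions
    (realR : ∀ (ρ : ↥S → ℝ) (r : ℝ), 0 ≤ r → (∀ j, j ≤ n → ∀ z : ↥S, z.1 ∈ Ω j → wt L η j ^ 2 * |ρ z| ≤ r) →
      ∀ j, j ≤ n → ∀ w : ↥S, w.1 ∈ Ω j →
        wt L η j ^ 2 * |ρ w - ∑ z : ↥S, (T⁻¹ * (Qᵀ * ((Q * T⁻¹ * T⁻¹ * Qᵀ)⁻¹ * (Q * T⁻¹)))) w z * ρ z| ≤ BR * r) :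
    ∃ (g Δ : (Site d → 𝔸) →ₗ[ℂ] (Site d → 𝔸)) (q : (Site d → 𝔸) →ₗ[ℂ] (ℕ → Site d → 𝔸))
      (qs : (ℕ → Site d → 𝔸) →ₗ[ℂ] (Site d → 𝔸)) (Aw c : (ℕ → Site d → 𝔸) →ₗ[ℂ] (ℕ → Site d → 𝔸))
      (H' : XSpace d n 𝔸 →ₗ[ℂ] (Site d → 𝔸)),
      (∀ x, ∀ y ∈ Ω 0, (Δ (g x) + qs (Aw (q (g x)))) y = x y) ∧ (∀ f, q (g (g (qs (c (q f))))) = q f) ∧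
      (∀ (f : Site d → 𝔸), ∀ x ∈ Ω 0, Δ f x = covLap η (1 : Site d → Fin d → 𝔸ˣ) ((Ω 0).indicator f) x) ∧
      (∀ (μ : ℕ → Site d → 𝔸), ∀ x ∈ Ω 0, qs μ x = QT L n Λs (1 : Site d → Fin d → 𝔸ˣ) μ x) ∧
      (∀ (f : Site d → 𝔸) (j : ℕ), j ≤ n → ∀ y ∈ Λs j, q f j y = QprimeIter (zdBlocking d L) (bgT L (1 : Site d → Fin d → 𝔸ˣ)) j f y) ∧
      (∀ (X : XSpace d n 𝔸) (x : Site d), ‖H' X x‖ ≤ B₀'H * ‖X‖) ∧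
      (∀ j, j ≤ n → ∀ (X : XSpace d n 𝔸), ∀ p ∈ {b : Site d × Fin d | SideTouches (Ω j) b.1 b.2},
        wt L η j * ‖covDerivFwd η (1 : Site d → Fin d → 𝔸ˣ) p.2 (H' X) p.1‖ ≤ B₀'H * ‖X‖) ∧
      (∀ X : XSpace d n 𝔸, Bd2 L η n Ω (covLap η (1 : Site d → Fin d → 𝔸ˣ) (H' X)) (B₂' * ‖X‖)) ∧
      (∀ (X : XSpace d n 𝔸) (x : Site d), x ∉ Ω 0 → H' X x = 0) ∧
      (∀ X Y : XSpace d n 𝔸, (∀ p, Y p = -star (X p)) → ∀ x, H' Y x = -star (H' X x)) ∧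
      (∀ (Y : XSpace d n 𝔸) (j : ℕ) (hj : j ≤ n) (y : Site d), y ∈ Λs j →
        QprimeIter (zdBlocking d L) (bgT L (1 : Site d → Fin d → 𝔸ˣ)) j (H' Y) y = Y (⟨j, Nat.lt_succ_of_le hj⟩, y)) ∧
      (∀ (f : Site d → 𝔸) (r : ℝ), 0 ≤ r → Bd2 L η n Ω f r →
        (∀ x, ‖g f x‖ ≤ BG * r) ∧ ∀ j, j ≤ n → ∀ p ∈ {b : Site d × Fin d | SideTouches (Ω j) b.1 b.2},
          wt L η j * ‖covDerivFwd η (1 : Site d → Fin d → 𝔸ˣ) p.2 (g f) p.1‖ ≤ BG * r) ∧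
      (∀ (f : Site d → 𝔸) (x : Site d), x ∉ Ω 0 → g f x = 0) ∧
      (∀ f : Site d → 𝔸, (∀ j, j ≤ n → ∀ x ∈ Ω j, IsSelfAdjoint (f x)) → ∀ x, IsSelfAdjoint (g f x)) ∧
      (∀ (f : Site d → 𝔸) (r : ℝ), 0 ≤ r → Bd2 L η n Ω f r → Bd2 L η n Ω (f - g (qs (c (q (g f))))) (BR * r)) ∧
      (∀ f : Site d → 𝔸, (∀ j, j ≤ n → ∀ x ∈ Ω j, IsSelfAdjoint (f x)) →
        ∀ j, j ≤ n → ∀ x ∈ Ω j, IsSelfAdjoint ((f - g (qs (c (q (g f))))) x)) := by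
  -- the letters with the eleven laws and the four displayed kernels (g3's file 6)
  obtain ⟨g, Δ, q, qs, Aw, c, H', g_rightΩ, c_range, hΔ, hqs, hq, -, hHsupp, hHequiv, hQH, hGsupp, hGreal₀, hRreal₀, hgker, hcker,
    -, hHker⟩ := exists_flatLetters_dirichlet_explicit (𝔸 := 𝔸) hd hη.ne' hL n Λs a ha (Ω 0) S hS hmeet hdisj B hB K hK T hT Q hQ
  -- §1 the composite kernel of `G′QᵀCQG′`: `T⁻¹·Qᵀ·M⁻¹·Q·T⁻¹`, `M = QT⁻¹T⁻¹Qᵀ`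
  have hg_supp : ∀ (f : Site d → 𝔸) (w : Site d), w ∉ S → g f w = 0 := fun f w hw => hGsupp f w (fun h => hw ((hS w).mpr h))
  have hq_mem : ∀ (u : Site d → 𝔸), (∀ w, w ∉ S → u w = 0) → ∀ p : ↥B, q u p.1.1 p.1.2 = ∑ z : ↥S, (Q p z) • u z.1 := by
    intro u hu p
    have hp := (hB p.1).mp p.2
    rw [hq u p.1.1 hp.1 p.1.2 hp.2, QprimeIter_flat_eq_sum_of_supp hL S u hu p.1.1 p.1.2, ← Finset.sum_coe_sort S]
    exact Finset.sum_congr rfl fun z _ => by rw [hQ, Matrix.of_apply]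
  have hqg : ∀ (f : Site d → 𝔸) (p : ↥B), q (g f) p.1.1 p.1.2 = ∑ w : ↥S, ((Q * T⁻¹) p w) • f w.1 := by
    intro f p
    rw [hq_mem _ (hg_supp f) p, Finset.sum_congr rfl fun z _ => by rw [hgker f z]]
    exact kernel_comp Q T⁻¹ (fun w : ↥S => f w.1) p
  have hcqg : ∀ (f : Site d → 𝔸) (p : ↥B),
      c (q (g f)) p.1.1 p.1.2 = ∑ w : ↥S, (((Q * T⁻¹ * T⁻¹ * Qᵀ)⁻¹ * (Q * T⁻¹)) p w) • f w.1 := by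
    intro f p
    rw [hcker, Finset.sum_congr rfl fun p' _ => by rw [hqg f p']]
    exact kernel_comp (Q * T⁻¹ * T⁻¹ * Qᵀ)⁻¹ (Q * T⁻¹) (fun w : ↥S => f w.1) p
  have hqs_ker : ∀ (φ : ℕ → Site d → 𝔸) (z : ↥S), qs φ z.1 = ∑ p : ↥B, (Qᵀ z p) • φ p.1.1 p.1.2 := by
    intro φ z
    rw [hqs φ z.1 ((hS z.1).mp z.2), QT_flat_apply, tower_sum_eq L n Λs B hB φ z.1, ← Finset.sum_coe_sort B]
    exact Finset.sum_congr rfl fun p _ => by rw [Matrix.transpose_apply, hQ, Matrix.of_apply]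
  have hqscqg : ∀ (f : Site d → 𝔸) (z : ↥S),
      qs (c (q (g f))) z.1 = ∑ w : ↥S, ((Qᵀ * ((Q * T⁻¹ * T⁻¹ * Qᵀ)⁻¹ * (Q * T⁻¹))) z w) • f w.1 := by
    intro f z
    rw [hqs_ker, Finset.sum_congr rfl fun p _ => by rw [hcqg f p]]
    exact kernel_comp Qᵀ ((Q * T⁻¹ * T⁻¹ * Qᵀ)⁻¹ * (Q * T⁻¹)) (fun w : ↥S => f w.1) z
  have hR : ∀ (f : Site d → 𝔸) (w : ↥S),
      (fun f => g (qs (c (q (g f))))) f w.1 = ∑ z : ↥S, ((T⁻¹ * (Qᵀ * ((Q * T⁻¹ * T⁻¹ * Qᵀ)⁻¹ * (Q * T⁻¹)))) w z) • f z.1 := by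
    intro f w
    show g (qs (c (q (g f)))) w.1 = _
    rw [hgker _ w, Finset.sum_congr rfl fun z _ => by rw [hqscqg f z]]
    exact kernel_comp T⁻¹ (Qᵀ * ((Q * T⁻¹ * T⁻¹ * Qᵀ)⁻¹ * (Q * T⁻¹))) (fun z : ↥S => f z.1) w
  -- §2 the five bounds by the real-kernel ⊗ id transfer
  have hG := hG_flat_of_real L hη n Ω S hS g T⁻¹ hgker hGsupp realG
  obtain ⟨hH0, hH1, hH2⟩ := hH_flat_of_real L hη n Ω Λs S hS B hB H' (T⁻¹ * (T⁻¹ * Qᵀ) * (Q * T⁻¹ * T⁻¹ * Qᵀ)⁻¹) hHker hHsupp realH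
  have hRbd := hRbd_flat_of_real (𝔸 := 𝔸) L n Ω hΩ0 S hS (fun f => g (qs (c (q (g f)))))
    (T⁻¹ * (Qᵀ * ((Q * T⁻¹ * T⁻¹ * Qᵀ)⁻¹ * (Q * T⁻¹)))) hR realR
  refine ⟨g, Δ, q, qs, Aw, c, H', g_rightΩ, c_range, hΔ, hqs, hq, hH0, hH1, hH2, hHsupp, hHequiv, hQH, hG, hGsupp, ?_, ?_, ?_⟩
  · -- reality of `G′`
    intro f hf
    exact hGreal₀ f (fun x hx => hf 0 (Nat.zero_le _) x hx)
  · -- (1.98)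
    intro f r hr hf
    exact hRbd f r hr hf
  · -- reality of `R = 1 − G′QᵀCQG′`
    intro f hf j hj x hx
    rw [Pi.sub_apply]
    exact (hf j hj x hx).sub (hRreal₀ f (fun y hy => hf 0 (Nat.zero_le _) y hy) x)

end Letters

#print axioms flatLettersRD_of_real

end Literature.MathematicalPhysics.QuantumFieldTheory.Balaban1983to89.B8Eq191FlatLettersRDOfReal

end
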